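import Summits.HodgeConjecture.HodgeConjecture.Theorems.TropicalWeilObstructionTropicalWeilVanishingBoundaryHyperplane
import Summits.HodgeConjecture.HodgeConjecture.Theorems.TropicalWeilObstructionTropicalWeilVanishingFrameSpanSeeds
import Summits.HodgeConjecture.HodgeConjecture.Theorems.TropicalWeilObstructionTropicalWeilVanishingIntegralityLattice
import HarnessLib

/-!
# Route `TropicalWeilObstruction` (Kontsevich's tropical test — NEGATION SINK, exploration, no summit claim):
# the boundary of the calibration cone — III. frame span exactly `69` ⟺ calibrated

Negation-sink bookkeeping of the cell `pub-hodge-tropical` (seat tropical-1 gen 8); part III of the BOUNDARY series. Row (F) of the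
cell's K1-SCOPE (tropical-1 gen 6, `FrameSpan.finrank_span_frames_ge`, `…_of_offBoundary`) counts the span of the Plücker vectors
as functions on ALL `4`-words; part II counts the span of their restrictions to the `70` increasing words. Here:

* `pluckerCoord_eq_sum_wordOfRank` — alternating extension `p_L(S) = Σ_r det 1[S, I_r] p_L(I_r)` (Cauchy–Binet on increasing words);
* `finrank_span_frames_eq_finrank_span_restrictedFrames` — the two spans have the SAME dimension (restriction is injective on the span);
* `finrank_span_frames_eq`, `finrank_span_frames_eq_sixtyNine_iff_calibrated` — the exact direction count: for a NON-EMPTY effective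
  tropical `4`-cycle on a very general tropical Weil eightfold the `4`-directions of its cells span a HYPERPLANE of `⋀⁴ℝ⁸` (dimension
  `69`) iff the cycle is calibrated (`‖W(Z)‖ = μ(Z)`, class on the cone boundary), and ALL of `⋀⁴ℝ⁸` (`70`) otherwise;
* `profile_of_thetaCoord_eq_eight` — the profile of a MINIMAL counterexample to K1 (theta-degree `8`, p345948): calibrated, collinear
  complex determinants, exactly `69` independent `4`-directions.

HONEST STATUS. Decides nothing about K1 (open) or the Hodge conjecture. No definition, no named fact, no sorry.
References: [Zharkov2020TropicalWeil] I. Zharkov, arXiv:2002.02347, §2 (pp. 2–4); [MikhalkinZharkov2014Eigenwave] G. Mikhalkin,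
I. Zharkov, LN UMI 15 (2014), Prop. 4.3, Thm. 5.4.
-/

set_option linter.dupNamespace false

noncomputable section

open scoped BigOperators
open Matrix
open Literature.AlgebraicGeometry.Tropical
open Summit.HodgeConjecture.HodgeConjecture.Theorems.TropicalHodgeBound

namespace Summit.HodgeConjecture.HodgeConjecture.Theorems.TropicalWeilVanishing.Boundary

/-! ## §0 Display-only notation (the K3 skeleton's local definitions, verbatim bodies; nothing is defined) -/

/-- The skeleton's `thetaClass n Q`. -/
local notation3 (prettyPrint := false) "θ⟦" n "⟧" Q:max =>
  (fun S S' : Fin n → Fin (2 * n) => Matrix.det (Matrix.submatrix Q S S'))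

/-- The skeleton's `omegaFrame n` (`Ω = Pᴴ`). -/
local notation3 (prettyPrint := false) "Ω⟦" n "⟧" =>
  (Matrix.of fun (a : Fin (2 * n)) (b : Fin n) =>
    (if (a : ℕ) = (b : ℕ) then (1 : ℂ) else 0) - (if (a : ℕ) = (b : ℕ) + n then Complex.I else 0))

/-- The skeleton's `weilClassC n Q` (`w(Q) = (⋀ⁿQ ⊗ 1)(Ω ⊗ Ω)`). -/
local notation3 (prettyPrint := false) "wC⟦" n "⟧" Q:max =>
  (fun S S' : Fin n → Fin (2 * n) =>
    Matrix.det (Matrix.submatrix (Matrix.map Q ((↑) : ℝ → ℂ) * Ω⟦n⟧) S id) *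
      Matrix.det (Matrix.submatrix (Ω⟦n⟧) S' id))

/-- The skeleton's `weilClassRe n Q` (`w₁ = Re w`). -/
local notation3 (prettyPrint := false) "wRe⟦" n "⟧" Q:max =>
  (fun S S' : Fin n → Fin (2 * n) => Complex.re ((wC⟦n⟧ Q) S S'))

/-- The skeleton's `weilClassIm n Q` (`w₂ = Im w`). -/
local notation3 (prettyPrint := false) "wIm⟦" n "⟧" Q:max =>
  (fun S S' : Fin n → Fin (2 * n) => Complex.im ((wC⟦n⟧ Q) S S'))

/-- The hermitian MASS `μ(Z) = Σ_σ w_σ a_σ |η_σ|²` of an effective tropical `n`-cycle. Nothing is defined. -/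
local notation3 (prettyPrint := false) "μ⟦" n "," Z "⟧" =>
  (∑ σ, ((TropicalTorusCycle.cell Z σ).weight : ℝ) * (TropicalTorusCycle.cell Z σ).latticeVolume *
    ‖frameComplexDet n (TropicalTorusCycle.cell Z σ).frame‖ ^ 2)

variable (Q : Matrix (Fin (2 * 4)) (Fin (2 * 4)) ℝ)

/-! ## §5 The frame span on all words has the dimension of the restricted span (alternating extension) -/

/-- **Alternating extension from the increasing words:** `p_L(S) = Σ_{r<70} det 1[S, I_r] · p_L(I_r)` for every word `S`
(Cauchy–Binet on the increasing words with `A` = the rows `S` of `1`). [folklore] -/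
theorem pluckerCoord_eq_sum_wordOfRank (L : Matrix (Fin (2 * 4)) (Fin 4) ℤ) (S : Fin 4 → Fin (2 * 4)) :
    ((pluckerCoord L S : ℤ) : ℝ) = ∑ r : Fin 70, ((1 : Matrix (Fin (2 * 4)) (Fin (2 * 4)) ℝ).submatrix S (Chk.wordOfRank r)).det *
      ((pluckerCoord L (Chk.wordOfRank r) : ℤ) : ℝ) := by
  have h := sum_wordOfRank_det_mul_det (((1 : Matrix (Fin (2 * 4)) (Fin (2 * 4)) ℝ).submatrix S id)) (L.map ((↑) : ℤ → ℝ))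
  simp only [Matrix.submatrix_submatrix, Function.comp_id, Function.id_comp] at h
  have hmul : ((1 : Matrix (Fin (2 * 4)) (Fin (2 * 4)) ℝ).submatrix S id) * L.map ((↑) : ℤ → ℝ) =
      (L.map ((↑) : ℤ → ℝ)).submatrix S id := by
    conv_rhs => rw [← Matrix.one_mul (L.map ((↑) : ℤ → ℝ))]
    rw [Matrix.submatrix_mul _ _ S id id Function.bijective_id, Matrix.submatrix_id_id]
  rw [hmul] at h
  have hc : ∀ T : Fin 4 → Fin (2 * 4), ((pluckerCoord L T : ℤ) : ℝ) = ((L.map ((↑) : ℤ → ℝ)).submatrix T id).det := by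
    intro T
    have e := RingHom.map_det (Int.castRingHom ℝ) (L.submatrix T id)
    simp only [eq_intCast] at e
    rw [pluckerCoord, e]
    rfl
  rw [hc S, ← h]
  exact Finset.sum_congr rfl fun r _ => by rw [hc]

/-- **The frame span on all words has the same dimension as the restricted frame span on the `70` increasing words**
(restriction is injective on the span of the Plücker vectors, by alternating extension). So tropical-1 gen 6's counts
(`FrameSpan.finrank_span_frames_ge`, `…_of_offBoundary`: `≥ 69`, `≥ 70`) and the exact values here refer to the same number.
[folklore] -/
theorem finrank_span_frames_eq_finrank_span_restrictedFrames (Z : TropicalTorusCycle (2 * 4) 4 Q) :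
    Module.finrank ℝ (Submodule.span ℝ (Set.range fun σ : Fin Z.numCells =>
      fun S : Fin 4 → Fin (2 * 4) => ((pluckerCoord (Z.cell σ).frame S : ℤ) : ℝ))) =
    Module.finrank ℝ (Submodule.span ℝ (Set.range fun σ : Fin Z.numCells => fun r : Fin 70 =>
      ((pluckerCoord (Z.cell σ).frame (Chk.wordOfRank r) : ℤ) : ℝ))) := by
  classical
  set P : Fin Z.numCells → ((Fin 4 → Fin (2 * 4)) → ℝ) :=
    fun σ S => ((pluckerCoord (Z.cell σ).frame S : ℤ) : ℝ) with hP
  set ρ : ((Fin 4 → Fin (2 * 4)) → ℝ) →ₗ[ℝ] (Fin 70 → ℝ) :=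
    LinearMap.funLeft ℝ ℝ (fun r : Fin 70 => Chk.wordOfRank r) with hρ
  -- the alternating extension `ε`
  let ε : (Fin 70 → ℝ) →ₗ[ℝ] ((Fin 4 → Fin (2 * 4)) → ℝ) :=
    { toFun := fun c S => ∑ r : Fin 70, ((1 : Matrix (Fin (2 * 4)) (Fin (2 * 4)) ℝ).submatrix S (Chk.wordOfRank r)).det * c r
      map_add' := fun c d => by
        funext S; simp only [Pi.add_apply, mul_add, Finset.sum_add_distrib]
      map_smul' := fun a c => by
        funext S
        simp only [Pi.smul_apply, smul_eq_mul, RingHom.id_apply, Finset.mul_sum]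
        exact Finset.sum_congr rfl fun r _ => by ring }
  have hεP : ∀ σ, ε (ρ (P σ)) = P σ := by
    intro σ
    funext S
    show ∑ r : Fin 70, ((1 : Matrix (Fin (2 * 4)) (Fin (2 * 4)) ℝ).submatrix S (Chk.wordOfRank r)).det *
      ((pluckerCoord (Z.cell σ).frame (Chk.wordOfRank r) : ℤ) : ℝ) = ((pluckerCoord (Z.cell σ).frame S : ℤ) : ℝ)
    rw [← pluckerCoord_eq_sum_wordOfRank]
  set W : Submodule ℝ ((Fin 4 → Fin (2 * 4)) → ℝ) := Submodule.span ℝ (Set.range P) with hW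
  have hεW : ∀ f ∈ W, ε (ρ f) = f := by
    intro f hf
    refine Submodule.span_induction (p := fun f _ => ε (ρ f) = f) ?_ ?_ ?_ ?_ hf
    · rintro _ ⟨σ, rfl⟩; exact hεP σ
    · simp
    · intro f g _ _ hf hg; rw [map_add, map_add, hf, hg]
    · intro a f _ hf; rw [map_smul, map_smul, hf]
  have hinj : Function.Injective (ρ.domRestrict W) := by
    intro f g h
    apply Subtype.ext
    have h' : ρ f.1 = ρ g.1 := h
    rw [← hεW f.1 f.2, ← hεW g.1 g.2, h']
  have h1 := LinearMap.finrank_range_of_inj hinj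
  rw [LinearMap.range_domRestrict, hW, Submodule.map_span, ← Set.range_comp] at h1
  rw [← h1]
  rfl

/-- **FRAME SPAN EXACTLY `69` ⟺ CALIBRATED, `70` ⟺ NOT** — the exact form of the direction bound (row (F)) for a NON-EMPTY
effective tropical `4`-cycle at a very general Weil period with class `q₀ θ₄(Q) + q₁ Re w(Q) + q₂ Im w(Q)`: the Plücker vectors
of its cells span a HYPERPLANE of `⋀⁴ℝ⁸` iff the class is on the cone boundary (iff `‖W(Z)‖ = μ(Z)`), and all of `⋀⁴ℝ⁸` otherwise.
[cite: Zharkov2020TropicalWeil, §2] [cite: MikhalkinZharkov2014Eigenwave, Prop. 4.3 and Thm. 5.4] -/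
theorem finrank_span_frames_eq (hQ : Q.PosDef) (hJ : Q * weilJ 4 = weilJ 4 * Q) (hgen : IsWeilGeneric 4 Q)
    (Z : TropicalTorusCycle (2 * 4) 4 Q) (hZ : 0 < Z.numCells) {q₀ q₁ q₂ : ℝ}
    (hq : Z.cyc = q₀ • θ⟦4⟧ Q + q₁ • wRe⟦4⟧ Q + q₂ • wIm⟦4⟧ Q) :
    Module.finrank ℝ (Submodule.span ℝ (Set.range fun σ : Fin Z.numCells =>
      fun S : Fin 4 → Fin (2 * 4) => ((pluckerCoord (Z.cell σ).frame S : ℤ) : ℝ))) =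
      if 64 * (q₁ ^ 2 + q₂ ^ 2) = q₀ ^ 2 then 69 else 70 := by
  rw [finrank_span_frames_eq_finrank_span_restrictedFrames, finrank_span_restrictedFrames_eq Q hQ hJ hgen Z hZ hq]

/-- **Frame span `69` ⟺ calibrated** (non-empty effective cycle, very general Weil period). [cite: Zharkov2020TropicalWeil, §2]
[cite: MikhalkinZharkov2014Eigenwave, Prop. 4.3 and Thm. 5.4] -/
theorem finrank_span_frames_eq_sixtyNine_iff_calibrated (hQ : Q.PosDef) (hJ : Q * weilJ 4 = weilJ 4 * Q)
    (hgen : IsWeilGeneric 4 Q) (Z : TropicalTorusCycle (2 * 4) 4 Q) (hZ : 0 < Z.numCells) :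
    Module.finrank ℝ (Submodule.span ℝ (Set.range fun σ : Fin Z.numCells =>
      fun S : Fin 4 → Fin (2 * 4) => ((pluckerCoord (Z.cell σ).frame S : ℤ) : ℝ))) = 69 ↔
      ‖weilFunctional Z‖ = μ⟦4, Z⟧ := by
  obtain ⟨q, hq, -, -⟩ := FrameSpan.exists_coordinates_pos Q hQ hJ hgen Z hZ
  rw [finrank_span_frames_eq Q hQ hJ hgen Z hZ hq, norm_weilFunctional_eq_mass_iff_boundary Q hQ hJ Z hq]
  split_ifs with h
  · simp [h]
  · simp [h]

/-- **PROFILE OF A MINIMAL COUNTEREXAMPLE.** At a very general Weil period an effective tropical `4`-cycle with `W(Z) ≠ 0` of the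
minimal theta-degree `q₀ = 8` allowed by integrality (`Integrality.thetaCoord_ge_eight_of_weilFunctional_ne_zero`, p345948) is
CALIBRATED (its class is `8θ₄ ± Re w` or `8θ₄ ± Im w`, `Integrality.weilCoords_sq_eq_one_of_thetaCoord_eq_eight`): `‖W(Z)‖ = μ(Z)`,
all complex determinants `η_σ` of its cells lie on ONE real line, and the `4`-directions of its (at least `69`) cells span EXACTLY a
hyperplane of `⋀⁴ℝ⁸`. [cite: Zharkov2020TropicalWeil, §2 (pp. 2–4)] [cite: MikhalkinZharkov2014Eigenwave, Prop. 4.3 and Thm. 5.4] -/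
theorem profile_of_thetaCoord_eq_eight (hQ : Q.PosDef) (hJ : Q * weilJ 4 = weilJ 4 * Q) (hgen : IsWeilGeneric 4 Q)
    (Z : TropicalTorusCycle (2 * 4) 4 Q) {q₀ q₁ q₂ : ℝ}
    (hq : Z.cyc = q₀ • θ⟦4⟧ Q + q₁ • wRe⟦4⟧ Q + q₂ • wIm⟦4⟧ Q) (h8 : q₀ = 8) (hW : weilFunctional Z ≠ 0) :
    ‖weilFunctional Z‖ = μ⟦4, Z⟧ ∧ (∃ ζ : ℂ, ζ ≠ 0 ∧ ∀ σ, (ζ * frameComplexDet 4 (Z.cell σ).frame).re = 0) ∧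
      Module.finrank ℝ (Submodule.span ℝ (Set.range fun σ : Fin Z.numCells =>
        fun S : Fin 4 → Fin (2 * 4) => ((pluckerCoord (Z.cell σ).frame S : ℤ) : ℝ))) = 69 := by
  obtain ⟨h1, -⟩ := Integrality.weilCoords_sq_eq_one_of_thetaCoord_eq_eight Q hQ hJ hgen Z hq h8 hW
  have hbd : 64 * (q₁ ^ 2 + q₂ ^ 2) = q₀ ^ 2 := by rw [h1, h8]; norm_num
  refine ⟨(norm_weilFunctional_eq_mass_iff_boundary Q hQ hJ Z hq).mpr hbd, exists_collinear_of_boundary Q hQ hJ Z hq hbd, ?_⟩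
  rw [finrank_span_frames_eq Q hQ hJ hgen Z (FrameSpan.numCells_pos_of_weilFunctional_ne_zero Z hW) hq, if_pos hbd]

end Summit.HodgeConjecture.HodgeConjecture.Theorems.TropicalWeilVanishing.Boundary

end
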